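import Mathlib
import Summits.Ventures.HodgeRepro2.T5CyclotomicConjugation
import Summits.Ventures.HodgeRepro2.T5CyclotomicSubfieldSexticCensus

/-!
# THE INERT / SPLIT CENSUS OF EVERY CM SUBFIELD OF `ℚ(ζₘ)`, OF ANY DEGREE: `v` STAYS PRIME IFF `−1 ∈ ⟨p⟩` IN `(ℤ/mℤ)ˣ / H_F`

Tier-5 support N2 / N3 / §G-N4.2 (seat p3, gen 81). File 287 reads the census of a SEXTIC CM subfield `F ⊆ ℚ(ζₘ)` off
`(ℤ/mℤ)ˣ / H_F` through the parity of `ord(p · H_F)` — a criterion that needs `Gal(F/ℚ)` cyclic (file 281). For a CM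
subfield of ANY degree the criterion is the membership `c ∈ D(𝔭)` of file 97 (`conjGal_mem_stabilizer_iff`: the place
of `F⁺` under `𝔭` is non-split iff complex conjugation lies in the decomposition group), and this file reads it off
`(ℤ/mℤ)ˣ / H_F`:

* `mem_ker_restrictNormalHom_iff` (the kernel of `Gal(L/ℚ) → Gal(F/ℚ)` is `Gal(L/F)`, with the cell's `ℚ`-algebra
  instance on `F`), `algebraMap_restrictNormal_smul`, `restrictNormal_smul_under`, `fixingSubgroupEquiv_smul`: the
  restriction `Gal(L/ℚ) → Gal(F/ℚ)` is compatible with the Galois action on primes;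
* **`stabilizer_under_eq_map`**: for a Galois number field `L` and a Galois subfield `F`, the decomposition group of
  `𝔭 = P ∩ 𝓞_F` in `Gal(F/ℚ)` is the image of the decomposition group of `P` under `restrictNormalHom F` (`⊇` by the
  compatibility; `⊆` by lifting `τ` to `σ`, moving `σ • P` back to `P` by `Gal(L/F)`, which acts transitively on the
  primes above `𝔭`);
* `map_mem_map_iff`, `mk_mem_map_mk'_iff`: `f c ∈ f(S)` and `[c] ∈ [S]` both say `∃ s ∈ S, s⁻¹ c ∈ H`;
* **`ncard_primesOver_eq_one_iff_mem_zpowers`**: for `F ⊆ ℚ(ζₘ)` a CM subfield, `p ∤ m`, `𝔭 ∣ p` a prime of `F` and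
  `v = 𝔭 ∩ 𝓞_{F⁺}`: ONE prime of `F` above `v` ⟺ `(−1) · H_F ∈ ⟨p · H_F⟩` in `(ℤ/mℤ)ˣ / H_F`; the place-indexed form
  **`exists_map_eq_iff_mem_zpowers`** (`v 𝓞_F = w` for some `w` ⟺ the same) and `ncard_primesOver_eq_two_iff_notMem`.

For `Gal(F/ℚ)` cyclic, `(−1) · H_F ∈ ⟨p · H_F⟩` ⟺ `ord(p · H_F)` even (file 281's `mem_iff_two_dvd_card`), which is
file 287's criterion; the general one needs no cyclicity.

§8(d): uses an L-value-free non-vanishing device: NO.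
-/

open NumberField NumberField.IsCMField IsCyclotomicExtension.Rat Ideal MulAction IsDedekindDomain
  IsDedekindDomain.HeightOneSpectrum
open Summit.Ventures.HodgeRepro2.T5CMTypeGaloisDialect Summit.Ventures.HodgeRepro2.T5CyclotomicSubfieldInertiaDeg
  Summit.Ventures.HodgeRepro2.T5CyclotomicConjugation
open scoped Pointwise

namespace Summit.Ventures.HodgeRepro2.T5CyclotomicSubfieldDecomposition

section Group

variable {G G' : Type*} [Group G] [Group G']

/-- `f c ∈ f(S)` iff `s⁻¹ c ∈ ker f` for some `s ∈ S`. -/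
theorem map_mem_map_iff (f : G →* G') (S : Subgroup G) (c : G) :
    f c ∈ S.map f ↔ ∃ s ∈ S, s⁻¹ * c ∈ f.ker := by
  rw [Subgroup.mem_map]
  refine exists_congr fun s => and_congr_right fun _ => ?_
  rw [MonoidHom.mem_ker, map_mul, map_inv, inv_mul_eq_one]

/-- For an isomorphism `e`, `[e c] ∈ [e(S)]` in `G' ⧸ e(H)` iff `s⁻¹ c ∈ H` for some `s ∈ S`. -/
theorem mk_mem_map_mk'_iff (e : G ≃* G') (H S : Subgroup G) [(e.mapSubgroup H).Normal] (c : G) :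
    (QuotientGroup.mk (e c) : G' ⧸ e.mapSubgroup H) ∈
        (e.mapSubgroup S).map (QuotientGroup.mk' (e.mapSubgroup H)) ↔
      ∃ s ∈ S, s⁻¹ * c ∈ H := by
  rw [Subgroup.mem_map]
  constructor
  · rintro ⟨y, hy, hyc⟩
    obtain ⟨s, hs, rfl⟩ := hy
    refine ⟨s, hs, ?_⟩
    have h := QuotientGroup.eq.mp hyc
    change (e s)⁻¹ * e c ∈ Subgroup.map e.toMonoidHom H at h
    rw [← map_inv, ← map_mul] at h
    exact (Subgroup.mem_map_iff_mem e.injective).mp h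
  · rintro ⟨s, hs, hsc⟩
    refine ⟨e s, ⟨s, hs, rfl⟩, ?_⟩
    apply QuotientGroup.eq.mpr
    change (e s)⁻¹ * e c ∈ Subgroup.map e.toMonoidHom H
    rw [← map_inv, ← map_mul]
    exact (Subgroup.mem_map_iff_mem e.injective).mpr hsc

end Group

section Transport

variable {L : Type*} [Field L] [NumberField L] (F : IntermediateField ℚ L) [Normal ℚ F]

/-- The restriction of `σ` to `F` acts on `𝓞_F` compatibly with `σ` on `𝓞_L`. -/
theorem algebraMap_restrictNormal_smul (σ : L ≃ₐ[ℚ] L) (x : 𝓞 F) :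
    algebraMap (𝓞 F) (𝓞 L) (σ.restrictNormal F • x) = σ • algebraMap (𝓞 F) (𝓞 L) x := by
  apply Subtype.ext
  exact AlgEquiv.restrictNormal_commutes σ F (x : F)

/-- The kernel of the restriction `Gal(L/ℚ) → Gal(F/ℚ)` is `Gal(L/F)` (Mathlib's `restrictNormalHom_ker`, restated
with the `ℚ`-algebra structure of `F` as a division ring of characteristic `0` — the instance the cell's files carry — in
place of `IntermediateField.algebra'`). -/
theorem mem_ker_restrictNormalHom_iff (σ : L ≃ₐ[ℚ] L) :
    σ ∈ (AlgEquiv.restrictNormalHom F).ker ↔ σ ∈ F.fixingSubgroup := by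
  rw [MonoidHom.mem_ker, IntermediateField.mem_fixingSubgroup_iff]
  constructor
  · intro h x hx
    have h' := congrArg (fun τ : F ≃ₐ[ℚ] F => algebraMap F L (τ ⟨x, hx⟩)) h
    simp only [AlgEquiv.one_apply] at h'
    exact (AlgEquiv.restrictNormal_commutes σ F ⟨x, hx⟩).symm.trans h'
  · intro h
    ext x
    show algebraMap F L ((AlgEquiv.restrictNormalHom F σ) x) = algebraMap F L x
    exact (AlgEquiv.restrictNormal_commutes σ F x).trans (h x x.2)

/-- `σ|_F • (P ∩ 𝓞_F) = (σ • P) ∩ 𝓞_F`. -/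
theorem restrictNormal_smul_under (σ : L ≃ₐ[ℚ] L) (P : Ideal (𝓞 L)) :
    σ.restrictNormal F • P.under (𝓞 F) = (σ • P).under (𝓞 F) := by
  ext x
  have hinv : (σ.restrictNormal F)⁻¹ = σ⁻¹.restrictNormal F :=
    (map_inv (AlgEquiv.restrictNormalHom F) σ).symm
  rw [Ideal.mem_pointwise_smul_iff_inv_smul_mem, Ideal.mem_under, Ideal.mem_under,
    Ideal.mem_pointwise_smul_iff_inv_smul_mem, hinv, algebraMap_restrictNormal_smul]

omit [Normal ℚ F] in
/-- An element of `Gal(L/F)` and the same element of `Gal(L/ℚ)` act alike on the ideals of `𝓞_L`. -/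
theorem fixingSubgroupEquiv_smul (σ : F.fixingSubgroup) (Q : Ideal (𝓞 L)) :
    (IntermediateField.fixingSubgroupEquiv F σ) • Q = (σ : L ≃ₐ[ℚ] L) • Q := by
  ext x
  rw [Ideal.mem_pointwise_smul_iff_inv_smul_mem, Ideal.mem_pointwise_smul_iff_inv_smul_mem, ← map_inv]
  rfl

variable [IsGalois ℚ L]

/-- **THE DECOMPOSITION GROUP OF `𝔭 = P ∩ 𝓞_F` IN `Gal(F/ℚ)` IS THE IMAGE OF THE DECOMPOSITION GROUP OF `P`** under
the restriction `Gal(L/ℚ) → Gal(F/ℚ)` (`L/ℚ` Galois, `F` a Galois subfield). -/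
theorem stabilizer_under_eq_map (P : Ideal (𝓞 L)) [hP : P.IsPrime] :
    stabilizer (F ≃ₐ[ℚ] F) (P.under (𝓞 F)) =
      (stabilizer (L ≃ₐ[ℚ] L) P).map (AlgEquiv.restrictNormalHom F) := by
  haveI : IsGalois F L := IsGalois.tower_top_of_isGalois ℚ F L
  haveI : IsGaloisGroup (L ≃ₐ[F] L) (𝓞 F) (𝓞 L) := IsGaloisGroup.of_isFractionRing _ _ _ F L
  ext τ
  constructor
  · intro hτ
    obtain ⟨σ, rfl⟩ := AlgEquiv.restrictNormalHom_surjective (F := ℚ) (K₁ := F) (E := L) τ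
    have h1 : (σ • P).under (𝓞 F) = P.under (𝓞 F) := by
      rw [← restrictNormal_smul_under]
      exact hτ
    haveI : (σ • P).LiesOver (P.under (𝓞 F)) := ⟨h1.symm⟩
    obtain ⟨ρ, hρ⟩ := Ideal.exists_smul_eq_of_isGaloisGroup (P.under (𝓞 F)) (σ • P) P (L ≃ₐ[F] L)
    set ρ' : F.fixingSubgroup := (IntermediateField.fixingSubgroupEquiv F).symm ρ with hρ'
    refine ⟨(ρ' : L ≃ₐ[ℚ] L) * σ, ?_, ?_⟩
    · show ((ρ' : L ≃ₐ[ℚ] L) * σ) • P = P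
      rw [mul_smul, ← fixingSubgroupEquiv_smul, hρ', MulEquiv.apply_symm_apply]
      exact hρ
    · have hk : AlgEquiv.restrictNormalHom F (ρ' : L ≃ₐ[ℚ] L) = 1 := by
        rw [← MonoidHom.mem_ker, mem_ker_restrictNormalHom_iff]
        exact ρ'.2
      rw [map_mul, hk, one_mul]
  · rintro ⟨σ, hσ, rfl⟩
    show σ.restrictNormal F • P.under (𝓞 F) = P.under (𝓞 F)
    rw [restrictNormal_smul_under]
    change (σ • P).under (𝓞 F) = P.under (𝓞 F)
    rw [show σ • P = P from hσ]

end Transport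

section Census

variable (m : ℕ) [NeZero m] (L : Type*) [Field L] [NumberField L] [IsCyclotomicExtension {m} ℚ L] [IsCMField L]
  (F : IntermediateField ℚ L) [IsCMField F]
variable (p : ℕ) [hp : Fact p.Prime] (hpm : p.Coprime m)
  (𝔭 : Ideal (𝓞 F)) [h𝔭 : 𝔭.IsPrime] [h𝔭p : 𝔭.LiesOver (span {(p : ℤ)})]

include hpm h𝔭 h𝔭p in
/-- **THE CENSUS OF A CM SUBFIELD `F ⊆ ℚ(ζₘ)` OF ANY DEGREE**: the place of `F⁺` under a prime `𝔭` of `F` above `p ∤ m`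
has ONE prime of `F` above it iff `(−1) · H_F ∈ ⟨p · H_F⟩` in `(ℤ/mℤ)ˣ / H_F` — file 97's `c ∈ D(𝔭)` read through the
restriction from `ℚ(ζₘ)` (decomposition group `⟨p⟩`, conjugation `−1`, kernel `H_F`). -/
theorem ncard_primesOver_eq_one_iff_mem_zpowers :
    ((𝔭.under (𝓞 (maximalRealSubfield F))).primesOver (𝓞 F)).ncard = 1 ↔
      (QuotientGroup.mk (-1) : (ZMod m)ˣ ⧸ zmodSubgroup m L F) ∈
        Subgroup.zpowers (QuotientGroup.mk (ZMod.unitOfCoprime p hpm)) := by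
  classical
  haveI : IsGalois ℚ L := IsCyclotomicExtension.isGalois {m} ℚ L
  haveI : IsGalois ℚ F := T5CyclotomicUnramified.isGalois_intermediateField L m F
  rw [← T5CMDecomposition.conjGal_mem_stabilizer_iff F 𝔭]
  obtain ⟨⟨P, hP, hP𝔭⟩⟩ := (inferInstance : Nonempty (primesOver 𝔭 (𝓞 L)))
  haveI : P.LiesOver (span {(p : ℤ)}) := LiesOver.trans P 𝔭 (span {(p : ℤ)})
  haveI : P.IsMaximal := IsMaximal.of_liesOver_isMaximal P (span {(p : ℤ)})
  have h𝔭P : 𝔭 = P.under (𝓞 F) := Ideal.over_def P 𝔭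
  have hstab := stabilizer_under_eq_map F P
  have hconj := restrictNormalHom_conjGal L F
  rw [h𝔭P, hstab, ← hconj, map_mem_map_iff]
  refine (exists_congr fun s => and_congr_right fun _ => mem_ker_restrictNormalHom_iff F _).trans ?_
  -- the right-hand side through `galEquivZMod`
  rw [← galEquivZMod_conjGal m L]
  change _ ↔ (QuotientGroup.mk (galEquivZMod m L (conjGal L)) : (ZMod m)ˣ ⧸ zmodSubgroup m L F) ∈
    Subgroup.zpowers (QuotientGroup.mk' (zmodSubgroup m L F) (ZMod.unitOfCoprime p hpm))
  rw [← MonoidHom.map_zpowers, ← galEquivZMod_stabilizer m L p P hpm]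
  exact (mk_mem_map_mk'_iff (galEquivZMod m L) F.fixingSubgroup (stabilizer (L ≃ₐ[ℚ] L) P)
    (conjGal L)).symm

variable (v : HeightOneSpectrum (𝓞 (maximalRealSubfield F))) [hPv : 𝔭.LiesOver v.asIdeal]

include hpm h𝔭 h𝔭p hPv in
/-- **THE PLACE-INDEXED FORM**: a place `v` of `F⁺` above `p ∤ m` STAYS PRIME in `F` (`v 𝓞_F = w` for some `w`) iff
`(−1) · H_F ∈ ⟨p · H_F⟩` in `(ℤ/mℤ)ˣ / H_F` — for every CM subfield `F ⊆ ℚ(ζₘ)`, of any degree. -/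
theorem exists_map_eq_iff_mem_zpowers :
    (∃ w : HeightOneSpectrum (𝓞 F),
        Ideal.map (algebraMap (𝓞 (maximalRealSubfield F)) (𝓞 F)) v.asIdeal = w.asIdeal) ↔
      (QuotientGroup.mk (-1) : (ZMod m)ˣ ⧸ zmodSubgroup m L F) ∈
        Subgroup.zpowers (QuotientGroup.mk (ZMod.unitOfCoprime p hpm)) := by
  haveI : IsGalois ℚ F := T5CyclotomicUnramified.isGalois_intermediateField L m F
  have he : 𝔭.ramificationIdx ℤ = 1 :=
    T5CyclotomicUnramified.ramificationIdx_eq_one p L F ((Nat.Prime.coprime_iff_not_dvd hp.out).mp hpm) 𝔭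
  rw [T5CMFieldConjugationDecomposition.exists_map_eq_iff_smul_eq F v 𝔭
    (T5CMFieldCyclicGaloisCriterion.ramificationIdx_over_eq_one_of_eq_one F 𝔭 v he),
    T5CMDecomposition.complexConj_smul_eq_iff F 𝔭]
  exact ncard_primesOver_eq_one_iff_mem_zpowers m L F p hpm 𝔭

include hpm h𝔭 h𝔭p hPv in
/-- One prime of `F` above `v` iff `(−1) · H_F ∈ ⟨p · H_F⟩` (the place-indexed `ncard` form). -/
theorem ncard_primesOver_eq_one_iff_mem_zpowers' :
    (v.asIdeal.primesOver (𝓞 F)).ncard = 1 ↔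
      (QuotientGroup.mk (-1) : (ZMod m)ˣ ⧸ zmodSubgroup m L F) ∈
        Subgroup.zpowers (QuotientGroup.mk (ZMod.unitOfCoprime p hpm)) := by
  rw [← ncard_primesOver_eq_one_iff_mem_zpowers m L F p hpm 𝔭, ← Ideal.over_def 𝔭 v.asIdeal]

include hpm h𝔭 h𝔭p hPv in
/-- Two primes of `F` above `v` iff `(−1) · H_F ∉ ⟨p · H_F⟩`. -/
theorem ncard_primesOver_eq_two_iff_notMem :
    (v.asIdeal.primesOver (𝓞 F)).ncard = 2 ↔
      (QuotientGroup.mk (-1) : (ZMod m)ˣ ⧸ zmodSubgroup m L F) ∉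
        Subgroup.zpowers (QuotientGroup.mk (ZMod.unitOfCoprime p hpm)) := by
  rw [← ncard_primesOver_eq_one_iff_mem_zpowers' m L F p hpm 𝔭 v]
  rcases T5FinitePlaceSplitIff.ncard_primesOver_eq_one_or_two F v with h | h <;> rw [h] <;> norm_num

end Census

end Summit.Ventures.HodgeRepro2.T5CyclotomicSubfieldDecomposition
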